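import Mathlib
import Summits.Ventures.PercRepro2.SwOutJunctionH1GTyped

/-!
# The (H1) single junction on the general doubly typed side: the IN-HULL part (blind cell
PercRepro2, night-4 g34, 2026-08-28; proofs/NIGHT4-G34.md §3)

g33's block decomposition of the side `gOutSide` of an (H1) single-junction class (coarse orbits,
core cubes, shadow blocks; `rigidOK_g_of_junctionH1`) respects the status of the junction `u`
with respect to the hull of `h`: an out point's orbit consists of out points (the hull is constant
along an orbit), every point of a core cube or of a shadow block has `u` in the hull of `h`, and
the orbit of a plain escaping point consists of in-hull points.  Hence the rigid counting
inequality holds on the IN-HULL PART `{u ∈ hull(h)}` of the side by itself — the block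
decomposition with a predicate constant on the blocks (`rigidOK_g_of_blocks_pred`) summed over
the in-hull blocks: **`rigidOK_g_of_junctionH1_inHull`**.  This is the base of the iterated hull
split (SwOutHullSplitGTypedPred): a region with several junctions reduces to regions with fewer
junctions and to the parts where every remaining junction lies in the hull of `h`.
-/

namespace Summit.Ventures.PercRepro2

namespace LocRows

open Hull

variable {V : Type*} {E : Type*} [Fintype E] [DecidableEq E]

open scoped Classical

variable {ends : E → Sym2 V} {U : Set V} {ξ : Config E} {l h u : V}
  {𝓤 𝓓 𝓓'' : Set (Set V)} {X : Set V} {𝓤' : Set (Set V)} {F : V → Prop}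

section Blocks

/-- **The rigid inequality on a part from a block decomposition**: if a predicate `P` holds on
every side point of the block of a side point satisfying it, the rigid counting inequality holds on
the part `P` of the side (the blocks of the `P`-points, each with its own inequality). -/
theorem rigidOK_g_of_blocks_pred {K : Type*} (key : Config E → K) (block : K → Finset (Config E))
    (P : Config E → Prop)
    (hmem : ∀ ζ ∈ gOutSide ends l h 𝓤 𝓓 𝓓'' X 𝓤' U ξ, ζ ∈ block (key ζ))
    (hblock : ∀ ζ ∈ gOutSide ends l h 𝓤 𝓓 𝓓'' X 𝓤' U ξ, ∀ ζ' ∈ block (key ζ),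
      ζ' ∈ gTypedQ ends l h 𝓤 𝓓 𝓓'' X 𝓤' →
        ζ' ∈ gOutSide ends l h 𝓤 𝓓 𝓓'' X 𝓤' U ξ ∧ key ζ' = key ζ)
    (hP : ∀ ζ ∈ gOutSide ends l h 𝓤 𝓓 𝓓'' X 𝓤' U ξ, P ζ → ∀ ζ' ∈ block (key ζ),
      ζ' ∈ gTypedQ ends l h 𝓤 𝓓 𝓓'' X 𝓤' → P ζ')
    (hineq : ∀ ζ ∈ gOutSide ends l h 𝓤 𝓓 𝓓'' X 𝓤' U ξ, ∀ 𝓔 : Set (Set E), IsUpperSet 𝓔 →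
      ((block (key ζ)).filter fun ζ' =>
          ζ' ∈ gTypedQ ends l h 𝓤 𝓓 𝓓'' X 𝓤' ∧ redEdges ends ζ' h ∈ 𝓔).card ≤
        ((block (key ζ)).filter fun ζ' =>
          ζ' ∈ gTypedQ ends l h 𝓤 𝓓 𝓓'' X 𝓤' ∧ blueEdges ends ζ' h ∈ 𝓔).card)
    {𝓔 : Set (Set E)} (h𝓔 : IsUpperSet 𝓔) :
    ((gOutSide ends l h 𝓤 𝓓 𝓓'' X 𝓤' U ξ).filter fun ζ => P ζ ∧ redEdges ends ζ h ∈ 𝓔).card ≤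
      ((gOutSide ends l h 𝓤 𝓓 𝓓'' X 𝓤' U ξ).filter fun ζ => P ζ ∧ blueEdges ends ζ h ∈ 𝓔).card := by
  set C := gOutSide ends l h 𝓤 𝓓 𝓓'' X 𝓤' U ξ with hC
  let S₀ : Finset K := (C.filter fun ζ => P ζ).image key
  have hmapR : ∀ ζ ∈ C.filter fun ζ => P ζ ∧ redEdges ends ζ h ∈ 𝓔, key ζ ∈ S₀ := fun ζ hζ =>
    Finset.mem_image_of_mem key
      (Finset.mem_filter.2 ⟨(Finset.mem_filter.1 hζ).1, (Finset.mem_filter.1 hζ).2.1⟩)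
  have hmapB : ∀ ζ ∈ C.filter fun ζ => P ζ ∧ blueEdges ends ζ h ∈ 𝓔, key ζ ∈ S₀ := fun ζ hζ =>
    Finset.mem_image_of_mem key
      (Finset.mem_filter.2 ⟨(Finset.mem_filter.1 hζ).1, (Finset.mem_filter.1 hζ).2.1⟩)
  rw [Finset.card_eq_sum_card_fiberwise hmapR, Finset.card_eq_sum_card_fiberwise hmapB]
  refine Finset.sum_le_sum fun k hk => ?_
  obtain ⟨ζ₀, hζ₀, rfl⟩ := Finset.mem_image.1 hk
  rw [Finset.mem_filter] at hζ₀
  have hfib : ∀ (P' : Config E → Prop) [DecidablePred P'],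
      (C.filter fun ζ => P ζ ∧ P' ζ).filter (fun ζ => key ζ = key ζ₀) =
        (block (key ζ₀)).filter fun ζ' => ζ' ∈ gTypedQ ends l h 𝓤 𝓓 𝓓'' X 𝓤' ∧ P' ζ' := by
    intro P' _
    ext ζ'
    simp only [Finset.mem_filter]
    constructor
    · rintro ⟨⟨hζ', _, hP'⟩, hkey⟩
      have := hmem ζ' hζ'
      rw [hkey] at this
      exact ⟨this, (mem_gOutSide.1 hζ').1, hP'⟩
    · rintro ⟨hb, hQ, hP'⟩
      obtain ⟨hcl, hkey⟩ := hblock ζ₀ hζ₀.1 ζ' hb hQ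
      exact ⟨⟨hcl, hP ζ₀ hζ₀.1 hζ₀.2 ζ' hb hQ, hP'⟩, hkey⟩
  rw [hfib (fun ζ => redEdges ends ζ h ∈ 𝓔), hfib (fun ζ => blueEdges ends ζ h ∈ 𝓔)]
  exact hineq ζ₀ hζ₀.1 𝓔 h𝓔

end Blocks

section Main

variable (h𝓤 : IsUpperSet 𝓤) (h𝓓 : IsLowerSet 𝓓) (h𝓓'' : IsLowerSet 𝓓'') (h𝓤' : IsUpperSet 𝓤')
  (hl : l ∉ U) (hhu : h ≠ u) (hloop_h : ∀ e, ends e ≠ s(h, h))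
  (hloop_u : ∀ e, ends e ≠ s(u, u)) (hnadj : ∀ e, ends e ≠ s(h, u))
  (hF : ∀ x, F x → ∀ S ∈ 𝓤, x ∈ S)
  (hout : ∀ x ∈ U, x ≠ h → x ≠ u →
    F x ∨ x ∈ X ∨ (∃ e y, ends e = s(x, y) ∧ y ∉ U) ∨ (∀ e, x ∉ ends e))
  (hH1 : H1 ends U h u)
  (hhX : h ∉ X) (huX : u ∉ X) (hX : ∀ x ∈ X, x ∈ U → ∀ e, x ∈ ends e → ends e = s(x, x))
include hl hhu hloop_h hloop_u hnadj hF hout hhX huX hX hH1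

/-- **The blocks respect the hull**: every side point of the block of an in-hull side point has
`u` in the hull of `h` (a core cube, a shadow block, or the orbit of a plain escaping point). -/
theorem u_mem_hull_of_mem_blockOf_g {ζ : Config E} (hζ : ζ ∈ gOutSide ends l h 𝓤 𝓓 𝓓'' X 𝓤' U ξ)
    (hu : u ∈ hull ends ζ h) {ζ' : Config E}
    (hζ' : ζ' ∈ blockOf ends h u (keyOf ends U ξ h u ζ))
    (hQ : ζ' ∈ gTypedQ ends l h 𝓤 𝓓 𝓓'' X 𝓤') : u ∈ hull ends ζ' h := by
  by_cases hk : hull ends ζ u ⊆ U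
  · rw [keyOf_of_coreKind hu hk] at hζ'
    have hb : CoreBase ends (coreBaseOf ends ζ h u) h u (extHull ends ζ h u)
        (armsFun (armsC ends h u ζ)) (pureFun ends h (armsC ends h u ζ)) :=
      coreBase_of_coreKind_g hl hhu hloop_h hloop_u hnadj hF hout hX hH1 hζ ⟨hu, hk⟩
    obtain ⟨ω, rfl⟩ := (mem_coreCube).1 hζ'
    exact hb.u_mem_hull_coreReal ω
  by_cases hs : ShadowKind ends U ξ h u ζ
  · rw [keyOf_of_shadowKind hu hk hs] at hζ'
    exact (shadowKind_of_mem_shadowBlock_g hl hF hout hhX huX hX hs.1 hζ' hQ).2.2.2.2.2.1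
  · rw [keyOf_of_plain hu hk hs] at hζ'
    exact (mem_orbit_plain_g hl hhu hloop_h hloop_u hnadj hF hout hhX huX hX hH1 hζ hu hk hs hζ'
      hQ).2.1

include h𝓤 h𝓓 h𝓓'' h𝓤' in
/-- **THE IN-HULL PART OF AN (H1) SINGLE-JUNCTION CLASS, GENERAL DOUBLY TYPED SIDE**: the rigid
counting inequality on the part `{u ∈ hull(h)}` of `gOutSide` of every class of an (H1)
single-junction region (the hypotheses of `rigidOK_g_of_junctionH1`). -/
theorem rigidOK_g_of_junctionH1_inHull {𝓔 : Set (Set E)} (h𝓔 : IsUpperSet 𝓔) :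
    ((gOutSide ends l h 𝓤 𝓓 𝓓'' X 𝓤' U ξ).filter fun ζ =>
        u ∈ hull ends ζ h ∧ redEdges ends ζ h ∈ 𝓔).card ≤
      ((gOutSide ends l h 𝓤 𝓓 𝓓'' X 𝓤' U ξ).filter fun ζ =>
        u ∈ hull ends ζ h ∧ blueEdges ends ζ h ∈ 𝓔).card :=
  rigidOK_g_of_blocks_pred (keyOf ends U ξ h u) (blockOf ends h u) (fun ζ => u ∈ hull ends ζ h)
    (fun _ hζ => mem_blockOf_keyOf_g hl hhu hF hout hX hζ)
    (fun _ hζ _ hζ' hQ =>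
      keyOf_eq_of_mem_blockOf_g h𝓤 h𝓓 h𝓓'' h𝓤' hl hhu hloop_h hloop_u hnadj hF hout hH1 hhX huX hX hζ
        hζ' hQ)
    (fun _ hζ hu _ hζ' hQ =>
      u_mem_hull_of_mem_blockOf_g hl hhu hloop_h hloop_u hnadj hF hout hH1 hhX huX hX hζ hu hζ' hQ)
    (fun _ hζ _ h𝓔' =>
      card_blockOf_le_g h𝓤 h𝓓 h𝓓'' h𝓤' hl hhu hloop_h hloop_u hnadj hF hout hH1 hhX huX hX hζ h𝓔')
    h𝓔

include h𝓤 h𝓓 h𝓓'' h𝓤' in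
/-- The in-hull inequality in the form of the iterated hull split: the part
`{S ⊆ hull(h)}` with `S = {u}`. -/
theorem rigidOK_g_of_junctionH1_inHull_set {𝓔 : Set (Set E)} (h𝓔 : IsUpperSet 𝓔) :
    ((gOutSide ends l h 𝓤 𝓓 𝓓'' X 𝓤' U ξ).filter fun ζ =>
        (∀ s ∈ ({u} : Set V), s ∈ hull ends ζ h) ∧ redEdges ends ζ h ∈ 𝓔).card ≤
      ((gOutSide ends l h 𝓤 𝓓 𝓓'' X 𝓤' U ξ).filter fun ζ =>
        (∀ s ∈ ({u} : Set V), s ∈ hull ends ζ h) ∧ blueEdges ends ζ h ∈ 𝓔).card := by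
  have := rigidOK_g_of_junctionH1_inHull (ξ := ξ) h𝓤 h𝓓 h𝓓'' h𝓤' hl hhu hloop_h hloop_u hnadj hF hout hH1
    hhX huX hX h𝓔
  simpa only [Set.mem_singleton_iff, forall_eq] using this

end Main

end LocRows

end Summit.Ventures.PercRepro2
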